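import Summits.HubbardSuperconductivity.HubbardSuperconductivity.Theses.WeakCouplingBCS
import Literature.MathematicalPhysics.QuantumLattice.PairFieldMomentum

/-!
# Crux `WcbcsSsbToTorusLRO` (item `stmt-HubbardSuperconductivity-2009`): what line `tangent-face-legendre-spine`
takes from item stmt-1089 `KacWindowPenalty.WindowInfraredBound` — negative-side support from the standing
disprover (generation 4), file 4 of 4

The lead's v2 skeleton imports item stmt-HubbardSuperconductivity-1089 (an OPEN crux of routes KacWindowPenalty /
FunctionFieldCertificate) BY NAME. Here its statement is written out VERBATIM as the hypothesis `hW`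
(definitionally the Theses decl `KacWindowPenalty.WindowInfraredBound`, which is not imported so that this file does
not depend on another route's Theses module) and two things are proved:

* `leak_of_windowInfraredBound` — 1089 yields the POINTWISE infrared leak at `(U, δ)` (the `hIR` input of the
  line's composition, stripped of its two idle grand-canonical hypotheses) at every `U > 0`, `δ ∈ (0, 1/2)`;
  only `U < U₀` is ever consumed by the line;
* `windowInfraredBound_smallest_momentum` — but 1089 speaks for EVERY `U > 0`: it forces, eventually along even
  sides, `pairStructureFactor dWaveFormFactor L ψ (1,0) ≤ 2πC·L` for every normalised `(N_L, S^z=0)`-sector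
  ground state — `‖Δ_d(m₁)ψ‖² = O(L³) = o(L⁴)` at the smallest non-zero momentum `m₁ = (1,0)` (wavelength `L`):
  no system-scale modulation of a `d`-wave condensate at ANY coupling, i.e. no canonical phase separation with a
  paired component — the item's own why-might-fail regime at strong coupling (mVMC, `U/t = 10`, `δ ≲ 0.2`).
  A line living at `U → 0⁺` inherits this `∀ U` exposure gratuitously and should carry the weak-coupling
  restriction (`∀ U ∈ Ioo 0 U₀`, the pointwise leak) instead of 1089 by name.

Folklore bookkeeping (`ZMod.valMinAbs`, one term of a non-negative sum). Workfile:
`Cruxes/WcbcsSsbToTorusLRO/Disproof.lean` §16.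
-/

noncomputable section

namespace Summit.HubbardSuperconductivity.WcbcsSsbToTorusLRO.Negative

open Matrix Literature.MathematicalPhysics.QuantumLattice
open Filter Set
open scoped Matrix ComplexOrder

/-! ### (i) 1089 ⇒ the pointwise leak -/

/-- **1089 ⇒ the pointwise infrared leak** at every `U > 0`, `δ ∈ (0,1/2)` (window `η := min ε₀ (b/(C+1))`;
the `let D` of 1089 is `pairFieldAt dWaveFormFactor L` and its summand is `pairStructureFactor`, definitionally). [folklore] -/
theorem leak_of_windowInfraredBound (hW : (∀ U : ℝ, 0 < U → ∀ δ ∈ Set.Ioo (0:ℝ) (1 / 2), ∃ C ε₀ : ℝ, 0 ≤ C ∧ 0 < ε₀ ∧ ∃ L₀ : ℕ, ∀ ε ∈ Set.Ioc (0:ℝ) ε₀, ∀ (L : ℕ) [NeZero L], L₀ ≤ L → Even L → let D : (Fin 2 → ZMod L) → Matrix (Finset (Literature.MathematicalPhysics.QuantumLattice.Orb (Literature.MathematicalPhysics.QuantumLattice.FermionTorus 2 L))) (Finset (Literature.MathematicalPhysics.QuantumLattice.Orb (Literature.MathematicalPhysics.QuantumLattice.FermionTorus 2 L))) ℂ :=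 fun m => ∑ x : Fin 2 → ZMod L, Complex.exp (-(2 * Real.pi * Complex.I * (((∑ i : Fin 2, m i * x i).val : ℕ) : ℂ) / (L : ℂ))) • Literature.MathematicalPhysics.QuantumLattice.localPair Literature.MathematicalPhysics.QuantumLattice.dWaveFormFactor L x; ∀ ψ : Literature.MathematicalPhysics.QuantumLattice.Fock (Literature.MathematicalPhysics.QuantumLattice.Orb (Literature.MathematicalPhysics.QuantumLattice.FermionTorus 2 L)), star ψ ⬝ᵥ ψ = 1 → Literature.MathematicalPhysics.QuantumLattice.IsGroundStateInSector (Literature.MathematicalPhysics.QuantumLattice.hubbardTorus 2 L 1 U) (2 * ⌊(1 - δ) * (L : ℝ) ^ 2 / 2⌋₊) 0 ψ → (∑ m : Fin 2 → ZMod L, if m ≠ 0 ∧ (2 * Real.pi / (L : ℝ)) ^ 2 * (∑ i : Fin 2, (((m i).valMinAbs : ℤ) : ℝ) ^ 2) ≤ ε ^ 2 then (star (Matrix.mulVec (D m) ψ) ⬝ᵥ Matrix.mulVec (D m) ψ).re / (L : ℝ) ^ 2 else 0) ≤ C * ε * (L : ℝ) ^ 2)) {U : ℝ} (hU : 0 <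 U) {δ : ℝ} (hδ : δ ∈ Set.Ioo (0:ℝ) (1 / 2)) :
    (∀ b : ℝ, 0 < b → ∃ η : ℝ, 0 < η ∧ ∀ᶠ k : ℕ in Filter.atTop,
    ∀ ψ : Fock (Orb (FermionTorus 2 (2 * k + 1 + 1))),
      IsGroundStateInSector (hubbardTorus 2 (2 * k + 1 + 1) 1 U) (2 * ⌊(1 - δ) * (((2 * k + 1 + 1) : ℕ) : ℝ) ^ 2 / 2⌋₊) 0 ψ → star ψ ⬝ᵥ ψ = 1 →
        (∑ m ∈ (Finset.univ.filter fun m : Literature.Probability.LatticeModels.TorusSite 2 (2 * k + 1 + 1) =>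
            m ≠ 0 ∧ momentumNormSq (2 * k + 1 + 1) m < η ^ 2),
          pairStructureFactor dWaveFormFactor (2 * k + 1 + 1) ψ m) / ((2 * k + 1 + 1 : ℕ) : ℝ) ^ 2 ≤ b) := by
  intro b hb
  obtain ⟨C, ε₀, hC, hε₀, L₀, hW⟩ := hW U hU δ hδ
  have hC1 : 0 < C + 1 := by linarith
  set η : ℝ := min ε₀ (b / (C + 1)) with hη_def
  have hη : 0 < η := lt_min hε₀ (div_pos hb hC1)
  have hηε : η ∈ Set.Ioc (0:ℝ) ε₀ := ⟨hη, min_le_left _ _⟩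
  have hCη : C * η ≤ b := by
    have h1 : η ≤ b / (C + 1) := min_le_right _ _
    have h2 : C * η ≤ C * (b / (C + 1)) := mul_le_mul_of_nonneg_left h1 hC
    have h3 : C * (b / (C + 1)) ≤ b := by
      rw [mul_div_assoc', div_le_iff₀ hC1]; nlinarith
    exact h2.trans h3
  refine ⟨η, hη, ?_⟩
  filter_upwards [Filter.eventually_ge_atTop L₀] with k hk
  intro ψ hψ hψ1
  have hL₀ : L₀ ≤ 2 * k + 1 + 1 := by omega
  have hEven : Even (2 * k + 1 + 1) := ⟨k + 1, by ring⟩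
  have key := hW η hηε (2 * k + 1 + 1) hL₀ hEven ψ hψ1 hψ
  have key' : (∑ m : Literature.Probability.LatticeModels.TorusSite 2 (2 * k + 1 + 1),
      if m ≠ 0 ∧ momentumNormSq (2 * k + 1 + 1) m ≤ η ^ 2 then
        pairStructureFactor dWaveFormFactor (2 * k + 1 + 1) ψ m else 0) ≤
      C * η * ((2 * k + 1 + 1 : ℕ) : ℝ) ^ 2 := key
  have hsub : (Finset.univ.filter fun m : Literature.Probability.LatticeModels.TorusSite 2 (2 * k + 1 + 1) =>
        m ≠ 0 ∧ momentumNormSq (2 * k + 1 + 1) m < η ^ 2) ⊆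
      (Finset.univ.filter fun m : Literature.Probability.LatticeModels.TorusSite 2 (2 * k + 1 + 1) =>
        m ≠ 0 ∧ momentumNormSq (2 * k + 1 + 1) m ≤ η ^ 2) := by
    intro m
    simp only [Finset.mem_filter, Finset.mem_univ, true_and]
    exact fun hm => ⟨hm.1, hm.2.le⟩
  have hle := Finset.sum_le_sum_of_subset_of_nonneg hsub
    (fun m _ _ => pairStructureFactor_nonneg dWaveFormFactor (2 * k + 1 + 1) ψ m)
  replace hle := hle.trans_eq (Finset.sum_filter _ _)
  have hLpos : (0 : ℝ) < ((2 * k + 1 + 1 : ℕ) : ℝ) ^ 2 := by positivity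
  rw [div_le_iff₀ hLpos]
  calc _ ≤ _ := hle
    _ ≤ C * η * ((2 * k + 1 + 1 : ℕ) : ℝ) ^ 2 := key'
    _ ≤ b * ((2 * k + 1 + 1 : ℕ) : ℝ) ^ 2 := mul_le_mul_of_nonneg_right hCη hLpos.le

/-! ### (ii) 1089 forbids system-scale pair modulation at every coupling -/

/-- The smallest non-zero momentum `m₁ = (1, 0)` has `|q_{m₁}|² = (2π/L)²` (`L ≥ 2`). [folklore] -/
theorem momentumNormSq_unit (L : ℕ) (hL : 2 ≤ L) :
    momentumNormSq L (![(1 : ZMod L), 0] : Literature.Probability.LatticeModels.TorusSite 2 L) =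
      (2 * Real.pi / (L : ℝ)) ^ 2 := by
  have h1 : ((1 : ZMod L)).valMinAbs = 1 := by
    rw [← Nat.cast_one, ZMod.valMinAbs_natCast_of_le_half (by omega)]
    rfl
  rw [momentumNormSq_apply, Fin.sum_univ_two]
  simp [h1, ZMod.valMinAbs_zero]

/-- `m₁ ≠ 0` (`L ≥ 2`). [folklore] -/
theorem unit_momentum_ne_zero (L : ℕ) (hL : 2 ≤ L) :
    (![(1 : ZMod L), 0] : Literature.Probability.LatticeModels.TorusSite 2 L) ≠ 0 := by
  intro h
  have h0 : (1 : ZMod L) = 0 := by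
    have := congrFun h 0
    simpa using this
  have h1 : ((1 : ZMod L)).valMinAbs = 1 := by
    rw [← Nat.cast_one, ZMod.valMinAbs_natCast_of_le_half (by omega)]
    rfl
  rw [h0, ZMod.valMinAbs_zero] at h1
  exact zero_ne_one h1

/-- **1089 forbids system-scale pair modulation at EVERY coupling.** For every `U > 0`, `δ ∈ (0, 1/2)`:
for all large even sides, every normalised `(N_L, S^z = 0)`-sector ground state of `hubbardTorus 2 L 1 U` has
`pairStructureFactor dWaveFormFactor L ψ (1,0) ≤ 2πC·L`, i.e. `‖Δ_d(m₁) ψ‖² ≤ 2πC L³ = o(L⁴)` (take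
`ε = 2π/L ≤ ε₀` in 1089 and keep the single window term `m₁`). [folklore] -/
theorem windowInfraredBound_smallest_momentum (hW : (∀ U : ℝ, 0 < U → ∀ δ ∈ Set.Ioo (0:ℝ) (1 / 2), ∃ C ε₀ : ℝ, 0 ≤ C ∧ 0 < ε₀ ∧ ∃ L₀ : ℕ, ∀ ε ∈ Set.Ioc (0:ℝ) ε₀, ∀ (L : ℕ) [NeZero L], L₀ ≤ L → Even L → let D : (Fin 2 → ZMod L) → Matrix (Finset (Literature.MathematicalPhysics.QuantumLattice.Orb (Literature.MathematicalPhysics.QuantumLattice.FermionTorus 2 L))) (Finset (Literature.MathematicalPhysics.QuantumLattice.Orb (Literature.MathematicalPhysics.QuantumLattice.FermionTorus 2 L))) ℂ := fun m => ∑ x : Fin 2 → ZMod L, Complex.exp (-(2 * Real.pi * Complex.I * (((∑ i : Fin 2, m i * x i).val : ℕ) : ℂ) / (L : ℂ))) • Literature.MathematicalPhysics.QuantumLattice.localPair Literature.MathematicalPhysics.QuantumLattice.dWaveFormFactor L x; ∀ ψ : Literature.MathematicalPhysics.QuantumLattice.Fock (Literature.MathematicalPhysics.QuantumLattice.Orb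 (Literature.MathematicalPhysics.QuantumLattice.FermionTorus 2 L)), star ψ ⬝ᵥ ψ = 1 → Literature.MathematicalPhysics.QuantumLattice.IsGroundStateInSector (Literature.MathematicalPhysics.QuantumLattice.hubbardTorus 2 L 1 U) (2 * ⌊(1 - δ) * (L : ℝ) ^ 2 / 2⌋₊) 0 ψ → (∑ m : Fin 2 → ZMod L, if m ≠ 0 ∧ (2 * Real.pi / (L : ℝ)) ^ 2 * (∑ i : Fin 2, (((m i).valMinAbs : ℤ) : ℝ) ^ 2) ≤ ε ^ 2 then (star (Matrix.mulVec (D m) ψ) ⬝ᵥ Matrix.mulVec (D m) ψ).re / (L : ℝ) ^ 2 else 0) ≤ C * ε * (L : ℝ) ^ 2)) {U : ℝ} (hU : 0 < U) {δ : ℝ}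
    (hδ : δ ∈ Set.Ioo (0:ℝ) (1 / 2)) :
    ∃ C : ℝ, 0 ≤ C ∧ ∃ L₁ : ℕ, ∀ (L : ℕ) [NeZero L], L₁ ≤ L → Even L →
      ∀ ψ : Fock (Orb (FermionTorus 2 L)), IsGroundStateInSector (hubbardTorus 2 L 1 U) (2 * ⌊(1 - δ) * ((L : ℕ) : ℝ) ^ 2 / 2⌋₊) 0 ψ →
        star ψ ⬝ᵥ ψ = 1 →
          pairStructureFactor dWaveFormFactor L ψ (![(1 : ZMod L), 0]) ≤ 2 * Real.pi * C * (L : ℝ) := by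
  obtain ⟨C, ε₀, hC, hε₀, L₀, hW⟩ := hW U hU δ hδ
  obtain ⟨N, hN⟩ := exists_nat_gt (2 * Real.pi / ε₀)
  refine ⟨C, hC, max (max L₀ N) 2, fun L _ hL hev ψ hψ hψ1 => ?_⟩
  have hL₀ : L₀ ≤ L := le_trans (le_trans (le_max_left _ _) (le_max_left _ _)) hL
  have hLN : N ≤ L := le_trans (le_trans (le_max_right _ _) (le_max_left _ _)) hL
  have hL2 : 2 ≤ L := le_trans (le_max_right _ _) hL
  have hLpos : (0 : ℝ) < (L : ℝ) := by positivity
  set ε : ℝ := 2 * Real.pi / (L : ℝ) with hε_def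
  have hεpos : 0 < ε := by positivity
  have hεle : ε ≤ ε₀ := by
    have hNL : (N : ℝ) ≤ (L : ℝ) := by exact_mod_cast hLN
    have h1 : 2 * Real.pi / ε₀ < (L : ℝ) := hN.trans_le hNL
    rw [div_lt_iff₀ hε₀] at h1
    rw [hε_def, div_le_iff₀ hLpos]
    linarith
  have key := hW ε ⟨hεpos, hεle⟩ L hL₀ hev ψ hψ1 hψ
  have key' : (∑ m : Literature.Probability.LatticeModels.TorusSite 2 L,
      if m ≠ 0 ∧ momentumNormSq L m ≤ ε ^ 2 then pairStructureFactor dWaveFormFactor L ψ m else 0) ≤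
      C * ε * (L : ℝ) ^ 2 := key
  set m₁ : Literature.Probability.LatticeModels.TorusSite 2 L := ![(1 : ZMod L), 0] with hm₁_def
  have hm₁ : m₁ ≠ 0 ∧ momentumNormSq L m₁ ≤ ε ^ 2 :=
    ⟨unit_momentum_ne_zero L hL2, (momentumNormSq_unit L hL2).le⟩
  have hterm : pairStructureFactor dWaveFormFactor L ψ m₁ ≤
      ∑ m : Literature.Probability.LatticeModels.TorusSite 2 L,
        if m ≠ 0 ∧ momentumNormSq L m ≤ ε ^ 2 then pairStructureFactor dWaveFormFactor L ψ m else 0 := by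
    have hnn : ∀ m ∈ (Finset.univ : Finset (Literature.Probability.LatticeModels.TorusSite 2 L)),
        0 ≤ (if m ≠ 0 ∧ momentumNormSq L m ≤ ε ^ 2 then pairStructureFactor dWaveFormFactor L ψ m else 0) := by
      intro m _
      split_ifs
      · exact pairStructureFactor_nonneg dWaveFormFactor L ψ m
      · exact le_rfl
    have := Finset.single_le_sum hnn (Finset.mem_univ m₁)
    rwa [if_pos hm₁] at this
  calc pairStructureFactor dWaveFormFactor L ψ m₁ ≤ _ := hterm
    _ ≤ C * ε * (L : ℝ) ^ 2 := key'
    _ = 2 * Real.pi * C * (L : ℝ) := by rw [hε_def]; field_simp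

end Summit.HubbardSuperconductivity.WcbcsSsbToTorusLRO.Negative

end
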